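import Summits.Ventures.CertifiedArithmetic.Expansions.CompressAdjacentReplay
import Mathlib.Tactic.Linarith
import Mathlib.Tactic.Positivity
import Mathlib.Tactic.Ring
import Mathlib.Tactic.NormNum

/-!
# COMPRESS under any tie rule: every component lies HALF-BELOW the next (new work)

New work of the certified-arithmetic venture (ENGINES group: shared numerical engines serving
client cells; rigour lives in the verifiers; every published number belongs to a client cell's
ledger, not to the engines group).  Theorem 23 of [Shewchuk1997, §2.7]: for a nonoverlapping
input, `COMPRESS(e)` is nonoverlapping under every round-to-nearest map and NONADJACENT under
round-to-even; `CompressAdjacentTiesAway` shows that other tie rules leave adjacent pairs, and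
`CompressAdjacentReplay` shows that an adjacent pair is mergeable or a tie replay.  THIS FILE
proves the sharp MAGNITUDE statement behind both, for EVERY round-to-nearest map `fl` (any tie
rule) and every precision `p ≥ 2`:

`compress_isChain_halfBelow`.  Consecutive components `a` (lower), `b` (upper) of
`COMPRESS(e)` satisfy `HalfBelow a b`: there is a grid `2^s` carrying `b` with `2|a| ≤ 2^s` —
`a` is at most HALF a bit that divides `b`.  Nonadjacency (`Below 2`) is the same with `<`;
so the output is "nonadjacent or touching", and a touching (= adjacent) pair has `2|a| = 2^s`
EXACTLY with `b ∉ 2^(s+1)ℤ`: the lower component is plus or minus half the lowest set bit of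
the upper one (`compress_adjacent_touching`) — which pins down the one-bit property
`LowOneBit` of `CompressAdjacencyInvariant` (there for `p ≥ 4`, inside a larger invariant) for
every `p ≥ 2`.  In particular the output is nonoverlapping (`HalfBelow.below_one`) — an
independent route to that half of Theorem 23.

PROOF.  The grid record of `CompressAdjacentReplay.RepInv` (the newest roundoff `r` sits below
a grid `2^u` on which the carry `Q` is normal) already decides it: in an emitting step
`(x, q) = FAST-TWO-SUM(g, Q)` the component `g`, the new carry `x` and the roundoff `q` all lie
on the grid `2^u` (`2^u ≤ |Q| ≤ ulp g`, the tree's `onGrid_fastTwoSum`), so `HalfBelow r q` with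
the witness `u`; the final pair `(r, Q)` is the record itself.  The sweep is run by
`CompressSweepInduction.compress_induction`.  HONEST FRAMING: the statement is not in the paper;
it was found on the venture's desk (integer model, `p = 2..8`, six tie rules and random
deterministic tie functions: 0 exceptions among ≈ 70 000 outputs; exhaustively for `p = 3` on
all nonoverlapping inputs with at most 4 components below `2^7`) and is proved here.
-/

namespace Summit.Ventures.CertifiedArithmetic.Expansions

open Literature.ComputerArithmetic.JeannerodRump2018
open Literature.ComputerArithmetic.BoldoJeannerodMelquiondMuller2023 hiding twoSum twoSum_fst
open Literature.ComputerArithmetic.Shewchuk1997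
open Literature.ComputerArithmetic

variable {p : ℕ} {emin : ℤ} {fl : ℚ → ℚ}

/-! ### The relation -/

/-- `a` lies HALF-BELOW `b`: some grid `2^s` carries `b` and `2|a| ≤ 2^s` (nonadjacency
`Below 2 a b` is the strict version). [cite: Shewchuk1997, §2.1 p. 309; Thm 23 p. 333] -/
def HalfBelow (a b : ℚ) : Prop := ∃ s : ℤ, OnGrid s b ∧ 2 * |a| ≤ (2 : ℚ) ^ s

/-- Nonadjacent pairs are half-below. [cite: Shewchuk1997, §2.1 p. 309] -/
theorem halfBelow_of_below_two {a b : ℚ} (h : Below 2 a b) : HalfBelow a b := by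
  obtain ⟨s, hs, hlt⟩ := h
  exact ⟨s, hs, hlt.le⟩

/-- Half-below pairs are nonoverlapping. [cite: Shewchuk1997, §2.1 p. 309] -/
theorem HalfBelow.below_one {a b : ℚ} (h : HalfBelow a b) : Below 1 a b := by
  obtain ⟨s, hs, hle⟩ := h
  refine ⟨s, hs, ?_⟩
  have h2 : (0 : ℚ) < (2 : ℚ) ^ s := zpow_pos (by norm_num) s
  rcases (abs_nonneg a).eq_or_lt with h0 | hpos
  · rw [← h0]; simpa using h2
  · linarith

/-- A half-below pair that is ADJACENT touches: `2|a| = 2^s` for a grid `2^s` carrying `b` but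
not `2^(s+1)` — `|a|` is half the lowest set bit of `b`. [cite: Shewchuk1997, Thm 23 p. 333] -/
theorem HalfBelow.touching_of_not_below {a b : ℚ} (h : HalfBelow a b) (hn : ¬ Below 2 a b) :
    ∃ s : ℤ, OnGrid s b ∧ ¬ OnGrid (s + 1) b ∧ 2 * |a| = (2 : ℚ) ^ s := by
  obtain ⟨s, hs, hle⟩ := h
  have heq : 2 * |a| = (2 : ℚ) ^ s := le_antisymm hle (not_lt.mp fun hlt => hn ⟨s, hs, hlt⟩)
  refine ⟨s, hs, fun hs1 => hn ⟨s + 1, hs1, ?_⟩, heq⟩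
  rw [heq]
  exact zpow_lt_zpow_right₀ (by norm_num) (by omega)

/-! ### The state property of the upward sweep -/

/-- The state property: the replay record of `CompressAdjacentReplay` (whose grid record is
what we use) together with the half-below chain along the emitted components, newest first.
[cite: Shewchuk1997, Thm 23 p. 333 (proof, Lines 10–16)] -/
def HbInv (p : ℕ) (emin : ℤ) (rs : List ℚ) (Q : ℚ) : Prop :=
  RepInv p emin rs Q ∧ rs.IsChain (flip HalfBelow)

/-- The property holds at every empty state. [cite: Shewchuk1997, Thm 23 p. 333 (proof)] -/
theorem HbInv.nil (Q : ℚ) : HbInv p emin [] Q := ⟨RepInv.nil Q, List.IsChain.nil⟩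

/-- In an emitting step from a carry `Q` normal on a grid `2^u ≥ 2^emin` (`Q ∈ 2^uℤ`,
`2^(p−1)·2^u ≤ |Q|`, `|Q| ≤ ulp g`), the emitted roundoff lies on that grid.
[cite: Shewchuk1997, Thm 23 p. 333 (proof, Line 12)] -/
theorem onGrid_emit (hp : 1 ≤ p) (hfl : IsRoundNearest p emin fl) {Q g : ℚ}
    (hg : IsFloat p emin g) (hQg : |Q| ≤ ulp p emin g) {u : ℤ} (hu : emin ≤ u)
    (huQ : OnGrid u Q) (hQbig : (2 : ℚ) ^ u * 2 ^ (p - 1) ≤ |Q|) :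
    OnGrid u (fastTwoSum fl g Q).2 := by
  have h2u : (2 : ℚ) ^ u ≤ |Q| :=
    le_trans (le_mul_of_one_le_right (zpow_nonneg (by norm_num) u)
      (one_le_pow₀ (by norm_num))) hQbig
  exact (onGrid_fastTwoSum hp hfl hu (onGrid_of_two_zpow_le_ulp hg (h2u.trans hQg)) huQ).2

/-- `HbInv` IS STABLE (`p ≥ 2`, any round-to-nearest): the record part is
`repInv_upStable`; the exact step does not touch the emitted components; in an emitting step
the new link `HalfBelow r q` between the old head `r` (below the grid `2^u`) and the emitted
`q ∈ 2^uℤ` has the witness `u`. [cite: Shewchuk1997, Thm 23 p. 333 (proof, Lines 10–16)] -/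
theorem hbInv_upStable (hp : 2 ≤ p) (hfl : IsRoundNearest p emin fl) :
    UpStable p emin fl 1 (HbInv p emin) where
  absorb {rs Q g} inv hinv hg hgbig hQg hq :=
    ⟨(repInv_upStable hp hfl).absorb inv hinv.1 hg hgbig hQg hq, hinv.2⟩
  emit {rs Q g} inv hinv hg hgbig hQg hq := by
    refine ⟨(repInv_upStable hp hfl).emit inv hinv.1 hg hgbig hQg hq,
      List.isChain_cons.mpr ⟨fun r hr => ?_, hinv.2⟩⟩
    show HalfBelow r (fastTwoSum fl g Q).2
    obtain ⟨u, hu, huQ, hr2, hQbig⟩ := hinv.1.hd r hr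
    exact ⟨u, onGrid_emit (by omega) hfl hg hQg hu huQ hQbig, hr2⟩

/-! ### The theorem -/

/-- **EVERY COMPONENT OF A COMPRESS OUTPUT LIES HALF-BELOW THE NEXT** (any round-to-nearest
`fl`, any tie rule, every `p ≥ 2`).  For a nonoverlapping expansion `e` of floats, consecutive
components `a, b` of `COMPRESS(e)` admit a grid `2^s ∋ b` with `2|a| ≤ 2^s`.
[cite: Shewchuk1997, Thm 23 p. 333; BoldoEtAl2023, §2.1] -/
theorem compress_isChain_halfBelow (hp : 2 ≤ p) (hfl : IsRoundNearest p emin fl) {e : List ℚ}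
    (he : ∀ x ∈ e, IsFloat p emin x) (hexp : IsExpansion 1 e) :
    (compress fl e).IsChain HalfBelow := by
  have hp1 : 1 ≤ p := by omega
  by_cases hne : e = []
  · subst hne; simp [compress]
  obtain ⟨rs, Q, hcomp, -, hinv⟩ := compress_induction hp hfl le_rfl
    (roundoffBelow_one hp1 hfl) (hbInv_upStable hp hfl) HbInv.nil he hexp hne
  rw [hcomp]
  refine isChain_output hinv.2 fun r hr => ?_
  obtain ⟨u, -, huQ, hr2, -⟩ := hinv.1.hd r hr
  exact ⟨u, huQ, hr2⟩

/-- Pointwise form: an ADJACENT consecutive pair `a, b` of `COMPRESS(e)` TOUCHES — `2|a| = 2^s`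
where `2^s` is the lowest set bit of `b` (`b ∈ 2^sℤ ∖ 2^(s+1)ℤ`); in particular `|a|` is a
power of two. [cite: Shewchuk1997, Thm 23 p. 333] -/
theorem compress_adjacent_touching (hp : 2 ≤ p) (hfl : IsRoundNearest p emin fl)
    {e : List ℚ} (he : ∀ x ∈ e, IsFloat p emin x) (hexp : IsExpansion 1 e)
    {t₁ t₂ : List ℚ} {a b : ℚ} (hab : compress fl e = t₁ ++ a :: b :: t₂)
    (hadj : ¬ Below 2 a b) :
    ∃ s : ℤ, OnGrid s b ∧ ¬ OnGrid (s + 1) b ∧ 2 * |a| = (2 : ℚ) ^ s := by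
  have hch := compress_isChain_halfBelow hp hfl he hexp
  rw [hab] at hch
  have hpair : HalfBelow a b := by
    have h2 : (a :: b :: t₂).IsChain HalfBelow := (List.isChain_append.mp hch).2.1
    exact (List.isChain_cons_cons.mp h2).1
  exact hpair.touching_of_not_below hadj

/-- The two descriptions of an adjacent output pair agree: by `CompressAdjacentReplay` it is
mergeable or a tie replay, by the present file it touches; for a TIE REPLAY the touching grid
is the ulp of `b` (`2|a| = ulp b`), otherwise it is coarser (`ulp b < 2|a|`, `b` an even
multiple of its ulp, and `a + b` is a float). [cite: Shewchuk1997, Thm 23 p. 333] -/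
theorem compress_adjacent_touching_ulp (hp : 2 ≤ p) (hfl : IsRoundNearest p emin fl)
    {e : List ℚ} (he : ∀ x ∈ e, IsFloat p emin x) (hexp : IsExpansion 1 e)
    {t₁ t₂ : List ℚ} {a b : ℚ} (hab : compress fl e = t₁ ++ a :: b :: t₂)
    (hadj : ¬ Below 2 a b) :
    2 * |a| = ulp p emin b ∨ (ulp p emin b < 2 * |a| ∧ IsFloat p emin (a + b)) := by
  have hp1 : 1 ≤ p := by omega
  obtain ⟨s, hs, hs1, heq⟩ := compress_adjacent_touching hp hfl he hexp hab hadj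
  -- `b` is a float of the output
  have hbmem : b ∈ compress fl e := by rw [hab]; simp
  have hbF : IsFloat p emin b :=
    (compress_spec hp hfl le_rfl (roundoffBelow_one hp1 hfl) he hexp).floats b hbmem
  obtain ⟨k, hk, hK⟩ := exists_ulp_eq_two_zpow (p := p) (emin := emin) b
  have hkb : OnGrid k b := onGrid_of_two_zpow_le_ulp hbF (le_of_eq hK.symm)
  -- the ulp grid is the finest grid carrying `b`, so `k ≤ s`
  by_cases hb0 : b = 0
  · exact absurd ⟨s + 1, by rw [hb0]; exact ⟨0, by simp⟩, by
      rw [heq]; exact zpow_lt_zpow_right₀ (by norm_num) (by omega)⟩ hadj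
  have hks : k ≤ s := by
    by_contra hlt
    exact hs1 (hkb.mono (by omega))
  rcases hks.eq_or_lt with hks | hks
  · left; rw [heq, hK, hks]
  · right
    refine ⟨by rw [heq, hK]; exact zpow_lt_zpow_right₀ (by norm_num) hks, ?_⟩
    have hpair : ReplayOrMerge p emin a b := by
      have hch := compress_replayOrMerge hp hfl he hexp
      rw [hab] at hch
      exact (List.isChain_cons_cons.mp (List.isChain_append.mp hch).2.1).1
    rcases hpair with h | h | h
    · exact absurd h hadj
    · exact h
    · -- a tie replay has `2|a| = ulp b`, contradicting `ulp b < 2|a|`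
      exfalso
      have h1 : 2 * |a| = ulp p emin b := h.1
      rw [heq, hK] at h1
      have := zpow_right_injective₀ (by norm_num : (0 : ℚ) < 2) (by norm_num) h1
      omega

end Summit.Ventures.CertifiedArithmetic.Expansions
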